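/-
Copyright (c) 2026. All rights reserved.
Released under Apache 2.0 license as described in the file LICENSE.
Authors: abc-iut cell, seat abc-iut-w5-d019 (gen 8).
-/
import Literature.GroupTheory.StronglyCompleteAbelianByAbelian
import Literature.GroupTheory.StronglyCompleteOfDerivedLayers

/-!
# The derived layers of open subgroups are open: closed derived subgroups + topological finite
# generation

Hypothesis (D) of `StronglyCompleteOfDerivedLayers.isOpen_of_finiteIndex` — "for every open subgroup
`H` of the profinite group `Γ`, every finite-index subgroup `L` with `⁅H, H⁆ ≤ L ≤ H` is open" — holds
as soon as

* every open subgroup `H` is topologically finitely generated (for `Γ` topologically finitely generated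
  this is Schreier's lemma, tree: `IsTopologicallyFinitelyGenerated.subgroup_isOpen`), and
* the ABSTRACT derived subgroup `⁅H, H⁆` of every open subgroup is closed (uniform commutator width in
  the finite quotients, `CommutatorClosedOfBoundedWidth.lean`),

because then `H / ⁅H, H⁆` is a topologically finitely generated ABELIAN profinite group, in which every
finite-index subgroup is open (tree: `StronglyCompleteAbelianByAbelian.isOpen_of_finiteIndex_quotient_of_
commutator_mem`, seat abc-iut-w5-d200; abelian case `IsTfgProfinite.isOpen_of_finiteIndex`).
Main results: `isOpen_of_commutator_le` (one open subgroup) and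
`isOpen_of_finiteIndex_of_commutator_closed` (the strong-completeness criterion of
`StronglyCompleteOfDerivedLayers.lean` with (D) discharged this way).

Consumer (cell abc-iut, GAP-LEDGER G-L3d2g2-1): strong completeness of the absolute Galois group of a
`p`-adic field.  Classical; no definition, no instance; nothing here bears on [IUTchIII] Cor. 3.12 or
asserts anything about abc.

[cite: RibesZalesskii2010, §4.2] [cite: DDMSAnalyticProP1999, Thm 1.17]
-/

namespace Literature.GroupTheory

namespace StronglyCompleteOfDerivedLayers

open scoped Pointwise

universe u

variable {Γ : Type u} [Group Γ] [TopologicalSpace Γ] [IsTopologicalGroup Γ] [CompactSpace Γ]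
  [TotallyDisconnectedSpace Γ]

/-- **A derived layer of an open subgroup is open.**  Let `H ≤ Γ` be an open subgroup of a profinite
group which is topologically finitely generated (as a topological group `↥H`) and whose abstract
derived subgroup `⁅H, H⁆` is closed.  Then every finite-index subgroup `L` with `⁅H, H⁆ ≤ L ≤ H` is open:
`L / ⁅H,H⁆` has finite index in the topologically finitely generated abelian profinite group
`H / ⁅H,H⁆`. [cite: RibesZalesskii2010, §4.2] -/
theorem isOpen_of_commutator_le (H : Subgroup Γ) (hH : IsOpen (H : Set Γ))
    (hS : ∃ S : Finset H, Dense ((Subgroup.closure (S : Set H) : Subgroup H) : Set H))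
    (hcl : IsClosed ((⁅H, H⁆ : Subgroup Γ) : Set Γ))
    (L : Subgroup Γ) (hHL : ⁅H, H⁆ ≤ L) (hLH : L ≤ H) [L.FiniteIndex] : IsOpen (L : Set Γ) := by
  -- the closed normal subgroup `C = ⁅H,H⁆ ∩ H` of the compact group `↥H`
  haveI : CompactSpace H :=
    isCompact_iff_compactSpace.mp (Subgroup.isClosed_of_isOpen H hH).isCompact
  haveI hCn : ((⁅H, H⁆ : Subgroup Γ).subgroupOf H).Normal :=
    ProfiniteSubquotients.normal_subgroupOf_of_commutator_le le_rfl
  have hCc : IsClosed ((((⁅H, H⁆ : Subgroup Γ).subgroupOf H) : Subgroup H) : Set H) :=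
    hcl.preimage continuous_subtype_val
  have hGC : ∀ x y : H, x * y * x⁻¹ * y⁻¹ ∈ (⁅H, H⁆ : Subgroup Γ).subgroupOf H := by
    intro x y
    rw [Subgroup.mem_subgroupOf]
    simpa [commutatorElement_def] using Subgroup.commutator_mem_commutator x.2 y.2
  -- the image `W` of `L ∩ H` in `↥H ⧸ C` has finite index
  haveI : (L.subgroupOf H).FiniteIndex := by
    refine ⟨fun h0 => ?_⟩
    have hmul := Subgroup.relIndex_mul_index hLH
    rw [Subgroup.relIndex, h0, zero_mul] at hmul
    exact Subgroup.FiniteIndex.index_ne_zero hmul.symm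
  haveI : ((L.subgroupOf H).map (QuotientGroup.mk' ((⁅H, H⁆ : Subgroup Γ).subgroupOf H))).FiniteIndex := by
    refine ⟨fun h0 => ?_⟩
    have hdvd := Subgroup.index_map_dvd (L.subgroupOf H) (QuotientGroup.mk'_surjective
      ((⁅H, H⁆ : Subgroup Γ).subgroupOf H))
    rw [h0, zero_dvd_iff] at hdvd
    exact Subgroup.FiniteIndex.index_ne_zero hdvd
  have hW := StronglyCompleteAbelianByAbelian.isOpen_of_finiteIndex_quotient_of_commutator_mem
    ((⁅H, H⁆ : Subgroup Γ).subgroupOf H) hCc hGC hS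
    ((L.subgroupOf H).map (QuotientGroup.mk' ((⁅H, H⁆ : Subgroup Γ).subgroupOf H)))
  -- pull back to `↥H`: the preimage of `W` is `L ∩ H` (as `⁅H,H⁆ ≤ L`)
  have hLH' : IsOpen ((L.subgroupOf H : Subgroup H) : Set H) := by
    have hpre := hW.preimage
      (QuotientGroup.continuous_mk (N := (⁅H, H⁆ : Subgroup Γ).subgroupOf H))
    have heq : ((L.subgroupOf H).map (QuotientGroup.mk' ((⁅H, H⁆ : Subgroup Γ).subgroupOf H))).comap
        (QuotientGroup.mk' ((⁅H, H⁆ : Subgroup Γ).subgroupOf H)) = L.subgroupOf H := by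
      rw [Subgroup.comap_map_eq, QuotientGroup.ker_mk', sup_eq_left]
      exact Subgroup.subgroupOf_mono H hHL
    rw [← heq, Subgroup.coe_comap]
    exact hpre
  -- and push forward along the open embedding `↥H → Γ`
  have himage : (L : Set Γ) = Subtype.val '' ((L.subgroupOf H : Subgroup H) : Set H) := by
    rw [← Subgroup.coe_subtype, ← Subgroup.coe_map, Subgroup.map_subgroupOf_eq_of_le hLH]
  rw [himage]
  exact hH.isOpenMap_subtype_val _ hLH'

/-- **Strong completeness from closed derived subgroups** (hypothesis (D) of
`isOpen_of_finiteIndex` discharged by `isOpen_of_commutator_le`).  Let `Γ` be a profinite group all of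
whose open subgroups are topologically finitely generated and have CLOSED abstract derived subgroup,
and let `P` (closed, elementwise pro-`p`) and `I` (`⁅Γ,Γ⁆ ≤ I`, `⁅I,I⁆ ≤ P`) be as in
`isOpen_of_finiteIndex`.  Then every finite-index subgroup of `Γ` is open.
[cite: RibesZalesskii2010, §4.2] [cite: DDMSAnalyticProP1999, Thm 1.17] -/
theorem isOpen_of_finiteIndex_of_commutator_closed {p : ℕ} [Fact p.Prime] (P : Subgroup Γ)
    (hPc : IsClosed (P : Set Γ))
    (hPp : ∀ σ ∈ P, ∀ W : Subgroup Γ, IsOpen (W : Set Γ) → ∃ a : ℕ, σ ^ p ^ a ∈ W)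
    (I : Subgroup Γ) (hI : commutator Γ ≤ I) (hIP : ⁅I, I⁆ ≤ P)
    (htfg : ∀ H : Subgroup Γ, IsOpen (H : Set Γ) →
      ∃ S : Finset H, Dense ((Subgroup.closure (S : Set H) : Subgroup H) : Set H))
    (hcl : ∀ H : Subgroup Γ, IsOpen (H : Set Γ) → IsClosed ((⁅H, H⁆ : Subgroup Γ) : Set Γ))
    (H₀ : Subgroup Γ) [H₀.FiniteIndex] : IsOpen (H₀ : Set Γ) :=
  isOpen_of_finiteIndex P hPc hPp I hI hIP
    (fun H hH L hHL hLH _ => isOpen_of_commutator_le H hH (htfg H hH) (hcl H hH) L hHL hLH) H₀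

end StronglyCompleteOfDerivedLayers

end Literature.GroupTheory
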